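import Literature.Analysis.FluidPDE.KwonPerturbedSuitable
import Literature.Analysis.FluidPDE.SpaceTimeRescaling
import Literature.Analysis.FluidPDE.LocalTypeIScaling
import HarnessLib

/-!
# Kwon's perturbed Navier–Stokes system: covariance under space–time rescaling

Analysis/FluidPDE proof file (theorems only; no definitions, no named facts) over the accepted
notion `Kwon2023.IsPerturbedSuitableOn` (`KwonPerturbedSuitable.lean`: H. Kwon, *The role of
the pressure in the regularity theory for the Navier–Stokes equations*, J. Differential
Equations 357 (2023) = arXiv:2104.03160, Def. 2.4 — suitable weak solutions of
`∂ₜv + λ(v·∇)v + (v·∇)h + (h·∇)v + ∇q = Δv + f`, `div v = div h = div f = 0` (gen.NS) on an open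
space–time region `O`, parameter `λ ∈ ℝ`).

`Kwon2023.IsPerturbedSuitableOn.stRescale` — **the scaling and translation of (gen.NS).** For
`α, γ > 0` and `Φ(s, y) = (t₀ + γ² s, x₀ + γ y)`: if `(v, q)` is a suitable weak solution of
(gen.NS) with parameter `λ`, drift `h` (weak spatial gradient `Dh`) and force `f` on `O`, then
`v' = α v ∘ Φ`, `q' = αγ q ∘ Φ` is one with parameter `λ' = λγ/α`, drift `h' = γ h ∘ Φ`
(gradient `γ² Dh ∘ Φ`) and force `f' = αγ² f ∘ Φ` on `Φ⁻¹(O)` (the viscosity is `1` in Def. 2.4,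
which forces the parabolic time-scale `γ²`; each term of the momentum equation tested with `ψ`
is `αγ²` times the corresponding term for the original data tested with `ψ ∘ Φ⁻¹`, each term of
the local energy inequality `α²γ²` times, the classes transport by the change of variables
`dz = γ^{2+n} dz'`). The two printed instances (Kwon, proof of Thm. 3.1, arXiv pp. 13–15):
`α = 1`, `γ = R` — "the rescaled pair `v_R(t,x) = v(R²t, Rx)`, `q_R = R q(R²t, Rx)`,
`h_R = R h(R²t, Rx)`, `f_R = R² f(R²t, Rx)` … is a suitable weak solution to (per.NS1) on `Q₁` for
`λ = R`" (the Claim); and `α = γ = 1/2` — "`ṽ(t,x) = 2⁻¹v(2⁻²t + t₀, 2⁻¹x + x₀)`, `q̃ = 2⁻²q(…)`,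
`h̃ = 2⁻¹h(…)`, `f̃ = 2⁻³f(…)` … is also a suitable weak solution to (per.NS) in `Q₁`" (λ
unchanged; the translation-and-scaling step before Campanato's lemma). Companion of the accepted
`IsSuitableWeakSolutionOn.stRescale` (`SuitableWeakRescaling.lean`, the case `h = 0`), whose
proof pattern is followed field by field.

## Mathlib / tree search

Reused: `stAffine`, `stPull`, `stPreimage`, `IsSpaceTimeTestOn.stPull_symm`, `stPull_stPull_symm`,
`timeDeriv/fderiv/convect/gradient/divergence/laplacian_stPull`, `smul_stPull_apply`,
`LocallyIntegrableOn.uncurry_stPull/comp_stAffine`, `HasWeakSpatialGradientOn.stRescale`,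
`setLIntegral_enorm_rpow_stRescale`, `setLIntegral_frobeniusNormSq_stRescale`,
`setIntegral_preimage_comp_stAffine`, `integral_integral_comp_stAffine`,
`lintegral_comp_space_affine`, `map_space_affine_volume`, `spaceAffineHomeomorph`,
`quasiMeasurePreserving_time_affine`, `ae_eq_restrict_comp_stAffine`, `measurable_stAffine`
(`SpaceTimeRescaling`); `map_time_affine_volume`, `measurableEmbedding_time_affine`
(`LocalTypeIScaling`). Mathlib: `MeasurableEmbedding.eLpNorm_map_measure`,
`eLpNormEssSup_smul_measure`, `eLpNorm_const_smul`, `MeasurableEmbedding.lintegral_map`,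
`lintegral_smul_measure`.

## References

* H. Kwon, J. Differential Equations 357 (2023) 1–31 = arXiv:2104.03160: Def. 2.4 (p. 7); proof
  of Thm. 3.1, the rescaled pair `(v_R, q_R, h_R, f_R)` (p. 13) and the transformed solution
  `(ṽ, q̃, h̃, f̃)` (p. 14). [Kwon2023RolePressure]
* L. Caffarelli, R. Kohn, L. Nirenberg, CPAM 35 (1982), §2 (scaling of suitable weak solutions,
  the case `h = 0`). [CaffarelliKohnNirenberg1982]
-/

noncomputable section

open MeasureTheory Set Function Filter Topology TopologicalSpace Metric Module
open scoped ENNReal NNReal RealInnerProductSpace InnerProductSpace Laplacian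

namespace Literature.Analysis.FluidPDE

variable {E : Type*} [NormedAddCommGroup E] [InnerProductSpace ℝ E] [FiniteDimensional ℝ E]
  [MeasurableSpace E] [BorelSpace E]

/-- Change of variables in time for lower Lebesgue integrals:
`∫⁻ g(t₀ + β s) ds = β⁻¹ ∫⁻ g(t) dt` (`β > 0`). [folklore] -/
private theorem lintegral_comp_time_affine {β : ℝ} (hβ : 0 < β) (t₀ : ℝ) (g : ℝ → ℝ≥0∞) :
    ∫⁻ s, g (t₀ + β * s) = ENNReal.ofReal β⁻¹ * ∫⁻ t, g t := by
  rw [← (measurableEmbedding_time_affine hβ.ne' t₀).lintegral_map, map_time_affine_volume hβ t₀,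
    lintegral_smul_measure, smul_eq_mul]

omit [FiniteDimensional ℝ E] in
/-- Transport of the spatial `L^∞` norm under `y ↦ x₀ + γ y` (`γ > 0`): the essential supremum is
invariant (the map pushes Lebesgue measure to a nonzero multiple of itself). [folklore] -/
private theorem eLpNorm_top_comp_space_affine [FiniteDimensional ℝ E] {F : Type*}
    [NormedAddCommGroup F] {γ : ℝ} (hγ : 0 < γ) (x₀ : E) (G : E → F) :
    eLpNorm (fun y => G (x₀ + γ • y)) ∞ (volume : Measure E) = eLpNorm G ∞ volume := by
  have hme : MeasurableEmbedding (fun y : E => x₀ + γ • y) := by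
    rw [← coe_spaceAffineHomeomorph hγ.ne' x₀]
    exact (spaceAffineHomeomorph hγ.ne' x₀).measurableEmbedding
  have h1 : (fun y => G (x₀ + γ • y)) = G ∘ fun y : E => x₀ + γ • y := rfl
  rw [h1, ← hme.eLpNorm_map_measure, map_space_affine_volume hγ x₀, eLpNorm_exponent_top,
    eLpNorm_exponent_top, eLpNormEssSup_ennreal_smul_measure]
  exact (ENNReal.ofReal_pos.2 (by positivity)).ne'

/-- A.e.-strong measurability on the domain transports along `Φ`:
`c · w ∘ Φ` is a.e.-strongly measurable on `Φ⁻¹(O)` if `w` is on `O`. [folklore] -/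
private theorem aestronglyMeasurable_smul_stPull {F : Type*} [NormedAddCommGroup F]
    [NormedSpace ℝ F] {O : Opens (ℝ × E)} {β γ : ℝ} (hβ : 0 < β) (hγ : 0 < γ) (t₀ : ℝ) (x₀ : E)
    (w : ℝ → E → F) (c : ℝ)
    (hw : AEStronglyMeasurable (uncurry w) (volume.restrict (O : Set (ℝ × E)))) :
    AEStronglyMeasurable (uncurry (c • stPull β γ t₀ x₀ w))
      (volume.restrict ((stPreimage β γ t₀ x₀ O : Opens (ℝ × E)) : Set (ℝ × E))) := by
  obtain ⟨g, hg, hwg⟩ := hw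
  refine ⟨fun z => c • g (stAffine β γ t₀ x₀ z),
    (hg.comp_measurable (measurable_stAffine β γ t₀ x₀)).const_smul c, ?_⟩
  rw [coe_stPreimage]
  filter_upwards [ae_eq_restrict_comp_stAffine hβ hγ t₀ x₀ hwg] with z hz
  have hz' : uncurry w (stAffine β γ t₀ x₀ z) = g (stAffine β γ t₀ x₀ z) := hz
  change c • w (t₀ + β * z.1) (x₀ + γ • z.2) = c • g (stAffine β γ t₀ x₀ z)
  rw [← hz']
  rfl

namespace Kwon2023.IsPerturbedSuitableOn

/-- **Scaling and translation of the perturbed system (gen.NS).** If `(v, q)` is a suitable weak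
solution of `∂ₜv + λ(v·∇)v + (v·∇)h + (h·∇)v + ∇q = Δv + f`, `div v = div h = div f = 0`, on
`O` in the sense of Kwon's Def. 2.4, with drift `h` (weak spatial gradient `Dh`) and force `f`,
then for `α, γ > 0` and `Φ(s, y) = (t₀ + γ² s, x₀ + γ y)` the data `v' = α v ∘ Φ`,
`q' = αγ q ∘ Φ`, `h' = γ h ∘ Φ`, `Dh' = γ² Dh ∘ Φ`, `f' = αγ² f ∘ Φ` form a suitable weak
solution of (gen.NS) with parameter `λγ/α` on `Φ⁻¹(O)`. Printed instances: `α = 1`, `γ = R`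
(`v_R(t,x) = v(R²t,Rx)`, `q_R = Rq`, `h_R = Rh`, `f_R = R²f` solve (per.NS1) with `λ = R`,
proof of Thm. 3.1, Claim) and `α = γ = 1/2` (`ṽ = 2⁻¹v(2⁻²t + t₀, 2⁻¹x + x₀)`, `q̃ = 2⁻²q`,
`h̃ = 2⁻¹h`, `f̃ = 2⁻³f`, `λ` unchanged; "By the translation and scale invariances of
(per.NS)", proof of Thm. 3.1, Hölder regularity of `v`).
[cite: Kwon2023RolePressure, proof of Thm. 3.1 (arXiv pp. 13–14), Def. 2.4] -/
theorem stRescale {O : Opens (ℝ × E)} {lam : ℝ} {h f v : ℝ → E → E}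
    {Dh : ℝ → E → E →L[ℝ] E} {q : ℝ → E → ℝ} (hs : IsPerturbedSuitableOn O lam h Dh f v q)
    {α γ : ℝ} (hα : 0 < α) (hγ : 0 < γ) (t₀ : ℝ) (x₀ : E) :
    IsPerturbedSuitableOn (stPreimage (γ ^ 2) γ t₀ x₀ O) (lam * γ / α)
      (γ • stPull (γ ^ 2) γ t₀ x₀ h) ((γ ^ 2) • stPull (γ ^ 2) γ t₀ x₀ Dh)
      ((α * γ ^ 2) • stPull (γ ^ 2) γ t₀ x₀ f) (α • stPull (γ ^ 2) γ t₀ x₀ v)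
      ((α * γ) • stPull (γ ^ 2) γ t₀ x₀ q) := by
  -- ### notation: `β = γ²`, `Φ = stAffine β γ t₀ x₀`, `O' = Φ⁻¹(O)`
  set β : ℝ := γ ^ 2 with hβ
  have hβ0 : 0 < β := by positivity
  set Φ := stAffine β γ t₀ x₀ with hΦ
  have hO' : ((stPreimage β γ t₀ x₀ O : Opens (ℝ × E)) : Set (ℝ × E)) =
      Φ ⁻¹' (O : Set (ℝ × E)) := coe_stPreimage β γ t₀ x₀ O
  have hcn : ENNReal.ofReal (γ ^ finrank ℝ E)⁻¹ ≠ ⊤ := ENNReal.ofReal_ne_top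
  -- ### the divergence constraints transport in the same way for `v`, `h`, `f`
  have hdiv : ∀ (w : ℝ → E → E) (c : ℝ),
      (∀ θ : ℝ → E → ℝ, IsSpaceTimeTestOn O θ →
        ∫ z in (O : Set (ℝ × E)), ⟪w z.1 z.2, gradient (θ z.1) z.2⟫ = 0) →
      ∀ θ : ℝ → E → ℝ, IsSpaceTimeTestOn (stPreimage β γ t₀ x₀ O) θ →
        ∫ z in ((stPreimage β γ t₀ x₀ O : Opens (ℝ × E)) : Set (ℝ × E)),
          ⟪(c • stPull β γ t₀ x₀ w) z.1 z.2, gradient (θ z.1) z.2⟫ = 0 := by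
    intro w c hw θ hθ
    set θ' := stPull β⁻¹ γ⁻¹ (-(β⁻¹ * t₀)) (-(γ⁻¹ • x₀)) θ with hθ'
    have hθ'Q : IsSpaceTimeTestOn O θ' := hθ.stPull_symm hβ0.ne' hγ.ne'
    have hrepr : θ = stPull β γ t₀ x₀ θ' := (stPull_stPull_symm hβ0.ne' hγ.ne' t₀ x₀ θ).symm
    set F : ℝ × E → ℝ := fun z' => ⟪w z'.1 z'.2, gradient (θ' z'.1) z'.2⟫ with hF
    have hzero : ∫ z in (O : Set (ℝ × E)), F z = 0 := hw θ' hθ'Q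
    have key : ∀ z : ℝ × E,
        ⟪(c • stPull β γ t₀ x₀ w) z.1 z.2, gradient (θ z.1) z.2⟫ = (c * γ) * F (Φ z) := by
      intro z
      conv_lhs => rw [hrepr]
      rw [gradient_stPull, smul_stPull_apply, real_inner_smul_left, real_inner_smul_right, hF]
      simp only [hΦ, stAffine_fst, stAffine_snd]
      ring
    rw [hO']
    simp_rw [key]
    rw [integral_const_mul, setIntegral_preimage_comp_stAffine hβ0 hγ, hzero, smul_zero,
      mul_zero]
  obtain ⟨G, hG, hG2, hlei⟩ := hs.localEnergy
  refine
    { locallyIntegrableOn := ?_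
      locallyIntegrableOn_sq := ?_
      energyClass := ?_
      aestronglyMeasurable_pressure :=
        aestronglyMeasurable_smul_stPull hβ0 hγ t₀ x₀ q (α * γ) hs.aestronglyMeasurable_pressure
      locallyIntegrableOn_pressure := ?_
      pressure := ?_
      drift := ?_
      driftClass := ?_
      drift_divFree := hdiv h γ hs.drift_divFree
      aestronglyMeasurable_force :=
        aestronglyMeasurable_smul_stPull hβ0 hγ t₀ x₀ f (α * γ ^ 2) hs.aestronglyMeasurable_force
      forceClass := ?_
      force_divFree := hdiv f (α * γ ^ 2) hs.force_divFree
      divFree := hdiv v α hs.divFree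
      momentum := ?_
      localEnergy := ⟨(α * γ) • stPull β γ t₀ x₀ G, hG.stRescale α hβ0 hγ t₀ x₀, ?_, ?_⟩ }
  · -- `v'` locally integrable
    have := (hs.locallyIntegrableOn.uncurry_stPull hβ0 hγ t₀ x₀).smul α
    exact this
  · -- `|v'|²` locally integrable
    have h1 : LocallyIntegrableOn ((α ^ 2) • ((fun z => ‖uncurry v z‖ ^ 2) ∘ Φ))
        (Φ ⁻¹' (O : Set (ℝ × E))) volume :=
      (hs.locallyIntegrableOn_sq.comp_stAffine hβ0 hγ t₀ x₀).smul (α ^ 2)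
    have heq : (fun z => ‖uncurry (α • stPull β γ t₀ x₀ v) z‖ ^ 2) =
        (α ^ 2) • ((fun z => ‖uncurry v z‖ ^ 2) ∘ Φ) := by
      funext z
      simp only [Pi.smul_apply, comp_apply, smul_eq_mul]
      change ‖(α • stPull β γ t₀ x₀ v) z.1 z.2‖ ^ 2 = α ^ 2 * ‖uncurry v (Φ z)‖ ^ 2
      rw [smul_stPull_apply, norm_smul, mul_pow, Real.norm_eq_abs, sq_abs]
      rfl
    rw [hO', heq]
    exact h1
  · -- `v' ∈ L^∞_t L²_x(O')`
    obtain ⟨C, hC⟩ := hs.energyClass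
    set F : ℝ × E → ℝ≥0∞ := fun z => ‖v z.1 z.2‖ₑ ^ 2 with hF
    have h2 : ∀ᵐ s : ℝ, ∫⁻ x, (O : Set (ℝ × E)).indicator F (t₀ + β * s, x) ≤ C :=
      (quasiMeasurePreserving_time_affine hβ0 t₀).ae hC
    set C₁ : ℝ≥0∞ := ‖α‖ₑ ^ 2 * (ENNReal.ofReal (γ ^ finrank ℝ E)⁻¹ * C) with hC₁
    have hC₁top : C₁ ≠ ∞ :=
      ENNReal.mul_ne_top (by simp) (ENNReal.mul_ne_top ENNReal.ofReal_ne_top ENNReal.coe_ne_top)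
    refine ⟨C₁.toNNReal, ?_⟩
    rw [ENNReal.coe_toNNReal hC₁top]
    filter_upwards [h2] with s hs'
    have key : ∀ y : E,
        ((stPreimage β γ t₀ x₀ O : Opens (ℝ × E)) : Set (ℝ × E)).indicator
            (fun z : ℝ × E => ‖(α • stPull β γ t₀ x₀ v) z.1 z.2‖ₑ ^ 2) (s, y) =
          ‖α‖ₑ ^ 2 * (O : Set (ℝ × E)).indicator F (t₀ + β * s, x₀ + γ • y) := by
      intro y
      have e1 : (fun z : ℝ × E => ‖(α • stPull β γ t₀ x₀ v) z.1 z.2‖ₑ ^ 2) =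
          fun z => ‖α‖ₑ ^ 2 * (F ∘ Φ) z := by
        funext z
        rw [smul_stPull_apply, enorm_smul, mul_pow]
        rfl
      rw [e1, hO']
      by_cases hz : ((t₀ + β * s, x₀ + γ • y) : ℝ × E) ∈ (O : Set (ℝ × E))
      · rw [indicator_of_mem (show ((s, y) : ℝ × E) ∈ Φ ⁻¹' (O : Set (ℝ × E)) from hz),
          indicator_of_mem hz]
        rfl
      · rw [indicator_of_notMem (show ((s, y) : ℝ × E) ∉ Φ ⁻¹' (O : Set (ℝ × E)) from hz),
          indicator_of_notMem hz, mul_zero]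
    simp_rw [key]
    rw [lintegral_const_mul' _ _ (by simp),
      lintegral_comp_space_affine hγ x₀ (fun x => (O : Set (ℝ × E)).indicator F (t₀ + β * s, x))]
    exact mul_le_mul' le_rfl (mul_le_mul' le_rfl hs')
  · -- `q'` locally integrable
    have := (hs.locallyIntegrableOn_pressure.uncurry_stPull hβ0 hγ t₀ x₀).smul (α * γ)
    exact this
  · -- `q' ∈ L^{3/2}(O')`
    rw [hO', setLIntegral_enorm_rpow_stRescale hβ0 hγ t₀ x₀ (α * γ) q _ (by norm_num)]
    exact ENNReal.mul_lt_top (ENNReal.mul_lt_top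
      (ENNReal.rpow_lt_top_of_nonneg (by norm_num) enorm_ne_top) ENNReal.ofReal_lt_top)
      hs.pressure
  · -- the weak spatial gradient of `h'`
    have hd := hs.drift.stRescale γ hβ0 hγ t₀ x₀
    rwa [← sq] at hd
  · -- `h' ∈ L²_t L^∞_x(O')`
    set N : ℝ → ℝ≥0∞ := fun t =>
      eLpNorm (fun x => (O : Set (ℝ × E)).indicator (uncurry h) (t, x)) ∞ volume with hN
    have key : ∀ s : ℝ,
        eLpNorm (fun y => ((stPreimage β γ t₀ x₀ O : Opens (ℝ × E)) : Set (ℝ × E)).indicator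
          (uncurry (γ • stPull β γ t₀ x₀ h)) (s, y)) ∞ volume = ‖γ‖ₑ * N (t₀ + β * s) := by
      intro s
      have e1 : (fun y => ((stPreimage β γ t₀ x₀ O : Opens (ℝ × E)) : Set (ℝ × E)).indicator
          (uncurry (γ • stPull β γ t₀ x₀ h)) (s, y)) =
          fun y => (γ • fun x => (O : Set (ℝ × E)).indicator (uncurry h) (t₀ + β * s, x))
            (x₀ + γ • y) := by
        funext y
        rw [hO']
        simp only [Pi.smul_apply]
        by_cases hz : ((t₀ + β * s, x₀ + γ • y) : ℝ × E) ∈ (O : Set (ℝ × E))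
        · rw [indicator_of_mem (show ((s, y) : ℝ × E) ∈ Φ ⁻¹' (O : Set (ℝ × E)) from hz),
            indicator_of_mem hz]
          rfl
        · rw [indicator_of_notMem (show ((s, y) : ℝ × E) ∉ Φ ⁻¹' (O : Set (ℝ × E)) from hz),
            indicator_of_notMem hz, smul_zero]
      rw [e1, eLpNorm_top_comp_space_affine hγ x₀, eLpNorm_const_smul, hN]
    simp_rw [key]
    have e2 : ∀ s : ℝ, (‖γ‖ₑ * N (t₀ + β * s)) ^ (2 : ℕ) = ‖γ‖ₑ ^ 2 * N (t₀ + β * s) ^ 2 :=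
      fun s => by rw [mul_pow]
    simp_rw [e2]
    have e3 : ∫⁻ s, N (t₀ + β * s) ^ 2 = ENNReal.ofReal β⁻¹ * ∫⁻ t, N t ^ 2 :=
      lintegral_comp_time_affine hβ0 t₀ (fun t => N t ^ 2)
    rw [lintegral_const_mul' _ _ (ENNReal.pow_ne_top enorm_ne_top), e3]
    exact ENNReal.mul_lt_top (ENNReal.pow_ne_top enorm_ne_top).lt_top
      (ENNReal.mul_lt_top ENNReal.ofReal_lt_top hs.driftClass)
  · -- `f' ∈ L¹_t L²_x(O')`
    set I : ℝ → ℝ≥0∞ := fun t =>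
      ∫⁻ x, (O : Set (ℝ × E)).indicator (fun z : ℝ × E => ‖f z.1 z.2‖ₑ ^ 2) (t, x) with hI
    have hc2 : ‖α * γ ^ 2‖ₑ ^ 2 ≠ ⊤ := ENNReal.pow_ne_top enorm_ne_top
    have key : ∀ s : ℝ,
        ∫⁻ y, ((stPreimage β γ t₀ x₀ O : Opens (ℝ × E)) : Set (ℝ × E)).indicator
          (fun z : ℝ × E => ‖((α * β) • stPull β γ t₀ x₀ f) z.1 z.2‖ₑ ^ 2) (s, y) =
          ‖α * γ ^ 2‖ₑ ^ 2 * (ENNReal.ofReal (γ ^ finrank ℝ E)⁻¹ * I (t₀ + β * s)) := by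
      intro s
      have e1 : ∀ y : E, ((stPreimage β γ t₀ x₀ O : Opens (ℝ × E)) : Set (ℝ × E)).indicator
          (fun z : ℝ × E => ‖((α * β) • stPull β γ t₀ x₀ f) z.1 z.2‖ₑ ^ 2) (s, y) =
          ‖α * γ ^ 2‖ₑ ^ 2 * (O : Set (ℝ × E)).indicator
            (fun z : ℝ × E => ‖f z.1 z.2‖ₑ ^ 2) (t₀ + β * s, x₀ + γ • y) := by
        intro y
        rw [hO']
        by_cases hz : ((t₀ + β * s, x₀ + γ • y) : ℝ × E) ∈ (O : Set (ℝ × E))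
        · rw [indicator_of_mem (show ((s, y) : ℝ × E) ∈ Φ ⁻¹' (O : Set (ℝ × E)) from hz),
            indicator_of_mem hz, smul_stPull_apply, enorm_smul, mul_pow, hβ]
        · rw [indicator_of_notMem (show ((s, y) : ℝ × E) ∉ Φ ⁻¹' (O : Set (ℝ × E)) from hz),
            indicator_of_notMem hz, mul_zero]
      simp_rw [e1]
      have e2 : ∫⁻ y : E, (O : Set (ℝ × E)).indicator (fun z : ℝ × E => ‖f z.1 z.2‖ₑ ^ 2)
          (t₀ + β * s, x₀ + γ • y) = ENNReal.ofReal (γ ^ finrank ℝ E)⁻¹ * I (t₀ + β * s) :=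
        lintegral_comp_space_affine hγ x₀
          (fun x => (O : Set (ℝ × E)).indicator (fun z : ℝ × E => ‖f z.1 z.2‖ₑ ^ 2)
            (t₀ + β * s, x))
      rw [lintegral_const_mul' _ _ hc2, e2]
    simp_rw [key]
    have e3 : ∀ s : ℝ, (‖α * γ ^ 2‖ₑ ^ 2 * (ENNReal.ofReal (γ ^ finrank ℝ E)⁻¹ * I (t₀ + β * s))) ^
        (1 / 2 : ℝ) = (‖α * γ ^ 2‖ₑ ^ 2 * ENNReal.ofReal (γ ^ finrank ℝ E)⁻¹) ^ (1 / 2 : ℝ) *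
          I (t₀ + β * s) ^ (1 / 2 : ℝ) := by
      intro s
      rw [← mul_assoc, ENNReal.mul_rpow_of_nonneg _ _ (by norm_num)]
    simp_rw [e3]
    have e4 : ∫⁻ s, I (t₀ + β * s) ^ (1 / 2 : ℝ) = ENNReal.ofReal β⁻¹ * ∫⁻ t, I t ^ (1 / 2 : ℝ) :=
      lintegral_comp_time_affine hβ0 t₀ (fun t => I t ^ (1 / 2 : ℝ))
    have hc3 : (‖α * γ ^ 2‖ₑ ^ 2 * ENNReal.ofReal (γ ^ finrank ℝ E)⁻¹) ^ (1 / 2 : ℝ) ≠ ⊤ :=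
      ENNReal.rpow_ne_top_of_nonneg (by norm_num) (ENNReal.mul_ne_top hc2 hcn)
    rw [lintegral_const_mul' _ _ hc3, e4]
    exact ENNReal.mul_lt_top hc3.lt_top (ENNReal.mul_lt_top ENNReal.ofReal_lt_top hs.forceClass)
  · -- the momentum equation
    intro ψ hψ
    set ψ' := stPull β⁻¹ γ⁻¹ (-(β⁻¹ * t₀)) (-(γ⁻¹ • x₀)) ψ with hψ'
    have hψ'Q : IsSpaceTimeTestOn O ψ' := hψ.stPull_symm hβ0.ne' hγ.ne'
    have hrepr : ψ = stPull β γ t₀ x₀ ψ' := (stPull_stPull_symm hβ0.ne' hγ.ne' t₀ x₀ ψ).symm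
    set F : ℝ × E → ℝ := fun z' => ⟪v z'.1 z'.2, timeDeriv ψ' z'.1 z'.2⟫ +
        lam * ⟪v z'.1 z'.2, convect (v z'.1) (ψ' z'.1) z'.2⟫ +
        ⟪h z'.1 z'.2, convect (v z'.1) (ψ' z'.1) z'.2⟫ +
        ⟪v z'.1 z'.2, convect (h z'.1) (ψ' z'.1) z'.2⟫ +
        ⟪v z'.1 z'.2, Δ (ψ' z'.1) z'.2⟫ +
        q z'.1 z'.2 * VectorCalculus.divergence (ψ' z'.1) z'.2 + ⟪f z'.1 z'.2, ψ' z'.1 z'.2⟫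
      with hF
    have hzero : ∫ z in (O : Set (ℝ × E)), F z = 0 := hs.momentum ψ' hψ'Q
    have key : ∀ z : ℝ × E,
        (⟪(α • stPull β γ t₀ x₀ v) z.1 z.2, timeDeriv ψ z.1 z.2⟫ +
          lam * γ / α * ⟪(α • stPull β γ t₀ x₀ v) z.1 z.2,
            convect ((α • stPull β γ t₀ x₀ v) z.1) (ψ z.1) z.2⟫ +
          ⟪(γ • stPull β γ t₀ x₀ h) z.1 z.2,
            convect ((α • stPull β γ t₀ x₀ v) z.1) (ψ z.1) z.2⟫ +
          ⟪(α • stPull β γ t₀ x₀ v) z.1 z.2,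
            convect ((γ • stPull β γ t₀ x₀ h) z.1) (ψ z.1) z.2⟫ +
          ⟪(α • stPull β γ t₀ x₀ v) z.1 z.2, Δ (ψ z.1) z.2⟫ +
          ((α * γ) • stPull β γ t₀ x₀ q) z.1 z.2 * VectorCalculus.divergence (ψ z.1) z.2 +
          ⟪((α * β) • stPull β γ t₀ x₀ f) z.1 z.2, ψ z.1 z.2⟫) =
        (α * β) * F (Φ z) := by
      intro z
      conv_lhs => rw [hrepr]
      rw [timeDeriv_stPull, convect_stPull, convect_stPull,
        laplacian_stPull _ _ _ _ _ _ _ (hψ'Q.contDiff_slice_two _), divergence_stPull,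
        smul_stPull_apply, smul_stPull_apply, smul_stPull_apply, smul_stPull_apply, stPull_apply,
        hF]
      simp only [hΦ, stAffine_fst, stAffine_snd, smul_eq_mul,
        real_inner_smul_left, real_inner_smul_right, convect_apply, map_smul]
      rw [hβ]
      field_simp
    rw [hO']
    simp_rw [key]
    rw [integral_const_mul, setIntegral_preimage_comp_stAffine hβ0 hγ, hzero, smul_zero,
      mul_zero]
  · -- `∇v' ∈ L²(O')`
    rw [hO', setLIntegral_frobeniusNormSq_stRescale hβ0 hγ]
    exact ENNReal.mul_lt_top (ENNReal.mul_lt_top ENNReal.ofReal_lt_top ENNReal.ofReal_lt_top)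
      hG2
  · -- the local energy inequality
    intro φ hφ hφ0
    set φ' := stPull β⁻¹ γ⁻¹ (-(β⁻¹ * t₀)) (-(γ⁻¹ • x₀)) φ with hφ'
    have hφ'Q : IsSpaceTimeTestOn O φ' := hφ.stPull_symm hβ0.ne' hγ.ne'
    have hrepr : φ = stPull β γ t₀ x₀ φ' := (stPull_stPull_symm hβ0.ne' hγ.ne' t₀ x₀ φ).symm
    have hφ'0 : ∀ t x, 0 ≤ φ' t x := fun t x => hφ0 _ _
    have key := hlei φ' hφ'Q hφ'0
    -- the dissipation term
    set D : ℝ → E → ℝ := fun t x => frobeniusNormSq (G t x) * φ' t x with hD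
    have keyD : ∀ s y, frobeniusNormSq (((α * γ) • stPull β γ t₀ x₀ G) s y) * φ s y =
        (α * γ) ^ 2 * D (t₀ + β * s) (x₀ + γ • y) := by
      intro s y
      have e : ((α * γ) • stPull β γ t₀ x₀ G) s y = (α * γ) • G (t₀ + β * s) (x₀ + γ • y) :=
        rfl
      conv_lhs => rw [hrepr]
      rw [e, frobeniusNormSq_smul, stPull_apply, hD]
      ring
    -- the right-hand side
    set R : ℝ → E → ℝ := fun t x => ‖v t x‖ ^ 2 * (timeDeriv φ' t x + Δ (φ' t) x) +
        ‖v t x‖ ^ 2 * ⟪lam • v t x + h t x, gradient (φ' t) x⟫ -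
        2 * ⟪Dh t x (v t x), v t x⟫ * φ' t x +
        2 * q t x * ⟪v t x, gradient (φ' t) x⟫ + 2 * ⟪f t x, v t x⟫ * φ' t x with hR
    have keyR : ∀ s y,
        ‖(α • stPull β γ t₀ x₀ v) s y‖ ^ 2 * (timeDeriv φ s y + Δ (φ s) y) +
          ‖(α • stPull β γ t₀ x₀ v) s y‖ ^ 2 *
            ⟪(lam * γ / α) • (α • stPull β γ t₀ x₀ v) s y + (γ • stPull β γ t₀ x₀ h) s y,
              gradient (φ s) y⟫ -
          2 * ⟪(β • stPull β γ t₀ x₀ Dh) s y ((α • stPull β γ t₀ x₀ v) s y),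
            (α • stPull β γ t₀ x₀ v) s y⟫ * φ s y +
          2 * ((α * γ) • stPull β γ t₀ x₀ q) s y *
            ⟪(α • stPull β γ t₀ x₀ v) s y, gradient (φ s) y⟫ +
          2 * ⟪((α * β) • stPull β γ t₀ x₀ f) s y, (α • stPull β γ t₀ x₀ v) s y⟫ * φ s y =
        (α ^ 2 * β) * R (t₀ + β * s) (x₀ + γ • y) := by
      intro s y
      have e : (β • stPull β γ t₀ x₀ Dh) s y = β • Dh (t₀ + β * s) (x₀ + γ • y) :=
        rfl
      conv_lhs => rw [hrepr]
      rw [timeDeriv_stPull, laplacian_stPull _ _ _ _ _ _ _ (hφ'Q.contDiff_slice_two _),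
        gradient_stPull, smul_stPull_apply, smul_stPull_apply, smul_stPull_apply,
        smul_stPull_apply, stPull_apply, e, hR]
      simp only [smul_eq_mul, norm_smul, Real.norm_eq_abs, abs_of_pos hα, mul_pow,
        real_inner_smul_left, real_inner_smul_right, smul_smul, inner_add_left,
        FunLike.coe_smul, Pi.smul_apply, map_smul]
      rw [hβ]
      field_simp
    simp_rw [keyD, keyR, integral_const_mul]
    rw [integral_integral_comp_stAffine hβ0 hγ t₀ x₀ D,
      integral_integral_comp_stAffine hβ0 hγ t₀ x₀ R]
    simp only [smul_eq_mul]
    have hc : 0 ≤ α ^ 2 * β * (β * γ ^ finrank ℝ E)⁻¹ := by positivity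
    have key' := mul_le_mul_of_nonneg_left key hc
    have e1 : 2 * ((α * γ) ^ 2 * ((β * γ ^ finrank ℝ E)⁻¹ * ∫ t, ∫ x, D t x)) =
        α ^ 2 * β * (β * γ ^ finrank ℝ E)⁻¹ * (2 * ∫ t, ∫ x, D t x) := by rw [hβ]; ring
    have e2 : α ^ 2 * β * ((β * γ ^ finrank ℝ E)⁻¹ * ∫ t, ∫ x, R t x) =
        α ^ 2 * β * (β * γ ^ finrank ℝ E)⁻¹ * ∫ t, ∫ x, R t x := by ring
    rw [e1, e2]
    exact key'

end Kwon2023.IsPerturbedSuitableOn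

end Literature.Analysis.FluidPDE

end
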